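import Literature.MathematicalPhysics.QuantumFieldTheory.Balaban1983to89.T4RecentScale
import Literature.MathematicalPhysics.QuantumFieldTheory.Dimock2015.AnalyticLipschitz

/-!
# T4BoundaryCarrier — a TYPED CARRIER for Bałaban's boundary pieces `𝐁^{(j)}(X; U, A)` (background AND pending
fluctuation field), the hypothesis shape «NE5-B» of their two-run rate, the kernel-checked three/four-bracket
bookkeeping, the hand-off to `T4RecentScale.FactorLogRatio` with kind `boundary`, and the Cauchy step "analytic in the
background with a margin ⇒ Lipschitz in the background UNIFORMLY in the fluctuation field" (cell `pub-balaban`, T4-DAG v4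
§5 row T4-U3.B, carver decision (α-B) = §8 Q13 / GAPS G-pv16g4-2; typing + bookkeeping only)

HONEST FRAMING (T4-DAG PAGE 1).  The cell's T4 target is rung (B)+1: existence AND uniqueness of the ε → 0 limit of
Bałaban's unit-scale averaged loop expectations on a FIXED finite torus — strictly beyond ultraviolet stability
([Balaban1988Convergent] Cor. 3 p. 264; [Balaban1989LargeFieldII] Thm 1 p. 355), NOT infinite volume, NOT a mass gap, NOT
the Clay problem.  Node U5b of the uniqueness spine compares, factor by factor, the final-scale density expansions of two
runs of the renormalization group (run A: K steps from spacing ε; run B: K + 1 steps from ε/L) driven by the SAME unit-lattice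
field after node U5a's synchronisation; the tree's `T4RecentScale` types that comparison for abstract factor ledgers and
instantiates it for ONE factor kind, the small-field terms `E^{(j)}(X)` (carrier `T4OutputRate.Functional` = (couplings,
background, domain) ↦ ℝ).  The BOUNDARY PIECES `exp 𝐁^{(j)}(X, U_k, A, {S_i∩X})` of (2.40)–(2.42) were left WITHOUT a typed
carrier (`T4RecentScale.Kind.boundary`: *"depend on the fluctuation fields A of pending integrations; NO typed carrier"*),
and the carver's decision (α-B) books them as RATE-matched members of the cell's NEW ESTIMATE NE5, carried by node U5.E as an
explicit `FactorLogRatio`-kind hypothesis.  NOTHING OF THIS COMPARISON IS PRINTED: the manuscripts under audit construct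
ONE run and bound its boundary pieces uniformly.  This module therefore ASSERTS NOTHING about Bałaban's objects: every
`def … : Prop` is a HYPOTHESIS SHAPE over ABSTRACT carriers (to be ASSUMED by U5.E / U5.E-b / U5.E-c, never used as a fact),
and every `theorem` is kernel-checked real/complex-analysis bookkeeping about the shapes.  The paper-level record with every
printed input quoted by page, the answer to the row's cross-read question and the located gaps is the cell record
`t4/T4-EST-U3B.md`.  Value = a typed carrier with the A-argument + exact quantifier order of the rate hypothesis + the
kernel form of the printed-ingredient Cauchy step uniform in A; NOT summit progress.

Printed context (verbatim, read on the ×2 journal-page renders by this seat; the manuscripts under audit are quoted for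
CONTEXT only — no disputed step of theirs is used anywhere below).
* THE A-ARGUMENT.  [Balaban1988Convergent] p. 258: *"The operation T^{(j)} involves integration with respect to the gauge
  field variables V_j on Ω^c_{j+1}∩X, and with respect to the fluctuation field variables A_j on Z_{j+1}∩Ω_{j+1}∩X"*; *"the
  quadratic form in the exponential couples only the fields A_j in the same component of Z_{j+1}∩Ω_{j+1}. The other terms
  of this quadratic form are included into the effective action into 𝐁-terms."*; *"Let us denote the system of the
  fluctuation fields {A_{j−1}} by A. The effective action A_k has the following general form: A_k(1/g_k², U_k) = −A(1/g_k²,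
  U_k) + 𝐄_k(U_k) + 𝐑_k(U_k) + 𝐁_k(U_k, A) − E_k. (2.23)"*; p. 259: *"The term 𝐁_k includes various expressions localized
  closely to large field regions. It does not require any renormalization."*; p. 260: *"The term 𝐁_k is the simplest term
  from the point of view of the renormalization, it does not need any renormalization, but it has the most complicated
  structure and properties. It is a sum of small, or at least bounded, localized terms, with localizations close to large
  field regions. The terms of 𝐁_k are analytic functions of the variables (𝐔, 𝐉) introduced in the same way as in the
  regular cases before. The analyticity domains are spaces defined"* → p. 261 *"similarly as in (I.1.11)–(I.1.16), but now
  we must take into account the existence of many different scales."*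
* THE MULTI-SCALE SPACE.  p. 261: *"The space Ũ^c_j(X, α̃₀, α̃₁) for X ∈ 𝐃_j is the set of configurations (𝐔, 𝐉) defined on
  X and satisfying the three conditions below. (i) 𝐔 = U′U, U has values in the group G, and the configurations […] satisfy
  the bounds |∂U − 1|, |∂𝐔 − 1| < (1 − β(1 − 2^{−(j−n)}))α_{0,n}ξ²(L^nξ)^{−2}, (2.34) […] |𝐉| < (1 − β(1 − 2^{−(j−n)}))α_{0,n}
  (L^nξ)^{−3}, (2.36) […] on X∩(Ω_n∖Ω_{n+1}) for n = 1, …, j − 1, or on X∩Ω_j for n = j."*, (iii) *"U′ = exp iξA′, A′ has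
  values in the algebra 𝐠^c, L^nξ|A′|, (L^nξ)²|∇^ξ_𝐔A′| < (1 − β(1 − 2^{−(j−n)}))α_{1,n} (2.39)"*, *"The number β is a small
  positive constant, but not too small, e.g., we can take β = 1/4."*
* THE INDUCTIVE DESCRIPTION OF THE BOUNDARY PIECES.  p. 261: *"Now we can write the form of 𝐁_k. It is given by the sum
  Σ_{j=1}^k 𝐁^{(j)}(U_k, A, {S_i}), (2.40) and a term in this sum has the localized representation 𝐁^{(j)}(U_k, A, {S_i}) =
  Σ_X 𝐁^{(j)}(X, U_k, A, {S_i∩X}), (2.41) where the sum is over domains X ∈ 𝐃_j such, that X∩Ω_j ≠ ∅, and X∩Z_j~ ≠ ∅. The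
  localized term in the sum on the right-hand side above has the following properties: (i) it depends on U_k, A
  restricted to X; (ii) it has an extension to an analytic function on the space Ũ^c_j(X, α̃₀, α̃₁); (iii) the extended
  function is invariant with respect to (G-valued) gauge transformations of 𝐔, 𝐉, A (the variables 𝐉, A are transformed
  by the adjoint representation of the gauge transformations); (iv) it satisfies the bound |𝐁^{(j)}(X, (𝐔, 𝐉), A,
  {S_i∩X})| < B₀ exp(−κd_j(X)). (2.42)"*; p. 262: *"the newly created expressions 𝐄^{(k)}, 𝐑^{(k)}, 𝐁^{(k)} are defined on
  slightly larger spaces, with the coefficients in their definition bigger by β multiplied by a corresponding number, and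
  they have better decay properties, with the number κ replaced, for example, by (1 + 4β)κ."*
* HOW NEW BOUNDARY PIECES ARISE IN THE T-STEP, AND THEIR JOINT ANALYTICITY SPACE.  p. 271: *"The first is the integral
  over t of the expectation value of the boundary terms, and it contributes to 𝐁^{(k+1)} only. The second is the integral
  over s of the expectation value of the R-terms, and it contributes to 𝐑^{(k+1)} and 𝐁^{(k+1)}. The third expression is
  the logarithm of the fluctuation field integral involving the regular terms of the effective action only, and it
  contributes to 𝐄^{(k+1)} and 𝐁^{(k+1)}."*, *"At first we separate obvious boundary terms connected with the external
  fluctuation field A_k, by expanding in this field. We introduce the parameter t multiplying A_k in the expressions in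
  the logarithm."*; p. 272 (after (3.28), whose first expectation value contains the functional derivative δχ^{(k)}/δA of
  the small-field characteristic function of the INTEGRATED field A, and the measure (3.29)): *"The first expression on the
  right-hand side of (3.28) is the expectation value of the sum of terms with at least one localization in the domain
  Ω_{k+1}∖Λ_{k+1}, hence this expression contributes to 𝐁^{(k+1)} only."*; p. 276: *"The remaining terms satisfy such
  conditions also, but with analyticity space (I.6.34) replaced by the space Ũ^c_{k+1}(Y, (1 + β)α̃₀, (1 + β)α̃₁) × {A :
  supp A ⊂ Y∩Λ^{(k)*}_{k+1}, |A| < C₁p₁(g_k)}. (3.43) Notice also that the localization domains occurring in this expansion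
  have nonempty intersections with Λ_{k+1}. These remaining terms will contribute to the boundary terms 𝐁^{(k+1)} in the
  final expansion."*, *"Terms of this expansion can be extended [as in (I.3.13)] to analytic functions defined on the
  corresponding spaces (3.43)."*; p. 277: *"on the other hand we have to use a part of the analyticity domains of terms in
  𝐁_k for the function 𝐇_k. This is the reason for putting the powers of 1/2 in the conditions (2.36)–(2.39). The
  analyticity domains become smaller after each step, but the difference is very small and exponentially decreasing in
  the number of steps. […] The terms of the expansion can be estimated as in (2.42), but with the additional factor O(ε_k)
  arising from the bound of the fluctuation field."*; p. 279: *"Thus we have finished the decomposition of the logarithm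
  of the fluctuation field integral in (3.25) into the sum of the three terms: 𝐄^{(k+1)}, 𝐑″^{(k+1)}, and 𝐁^{(k+1)}. These
  terms satisfy all the conditions of the inductive assumption."*  [Balaban1988Convergent, (3.27)–(3.29) pp. 271–272,
  (3.43) p. 276, pp. 277, 279]
* THE R-STEP BOUNDARY PIECES (background only, no coupling argument).  [Balaban1989LargeFieldII] p. 390: *"The expression
  𝐑′^{(k)}(X) depends on the background field U_k restricted to X, and it can be extended as an analytic function of the
  variables (𝐔, 𝐉), defined on the space Ũ^c_k(X, α̃₀, α̃₁). It is given by the convergent series (7.13) [I] (with proper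
  notational changes), and it satisfies the inequality |𝐑′^{(k)}(X, (𝐔, 𝐉))| ≤ O(1)c₁ exp(−(1 + ½β)κd_{k,∪Y_i}(X)). (1.99)"*,
  *"To the first group we assign all the terms with the localization domains X intersecting the large field region Z_k~ ∪
  ∪_{i=1}^m Y_i~ […]. The terms of the first group are new boundary terms, and they are denoted by 𝐁′^{(k)}(X)."*, and the
  new action *"A_k(1/(g_k(·))², U_k) = A′_k(1/(g_k(·))², U_k) + Σ_X 𝐑′^{(k)}(X, U_k) + Σ_X 𝐁′^{(k)}(X, U_k). (1.101)"*, with p. 390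
  l. 1 *"where c₁ = exp(−p₀(g_k)) if X′ does not intersect ∪_{i=1}^m Y_i, and c₁ = α^{1/3} in the remaining cases."*
  [Balaban1989LargeFieldII, (1.98)–(1.101) p. 390]
PRINTED TEMPLATE of the Cauchy step (PUBLISHED, outside the audited series): [DimockYuan2024GNFlow] proof of Thm 4, *"The
analyticity implies Lipschitz continuity in x_k and it is uniform in t"* — kernel form `Dimock2015.norm_sub_le_of_margin`
(‖g x − g y‖ ≤ (4M/ϱ)‖x − y‖ on a set whose closed ϱ-balls lie in the analyticity domain, M the sup bound).

NOT PRINTED anywhere in [Balaban1988Convergent], [Balaban1989LargeFieldI], [Balaban1989LargeFieldII] (cell record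
`t4/T4-EST-U3B.md` §4, located absence with null-search log): (a) any comparison of boundary pieces built at two lattice
spacings (the shape `NE5B` below — cell NEW ESTIMATE NE5, boundary-functional member; «NE5-B» iff an input outside NE5's
shape turns out to be needed); (b) any quantitative modulus of `𝐁^{(j)}(X; ·, A)` in the background or in A — print gives
analyticity on (3.43) / Ũ^c_j and the sup bound (2.42), from which a Cauchy estimate yields a modulus with constant of order
B₀/margin, the margin being a β-fraction of the g-DEPENDENT multi-scale radii α_{·,n} (2.28)/(2.34)–(2.39) (cell GAPS
G-t4-U3-2 verbatim for B-pieces) — §4 below carries out exactly this step in the kernel GIVEN the analytic extension, the sup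
bound and the margin as hypotheses; (c) the identification of the two runs' pending fluctuation variables after the pairing
j ↔ j + 1 (an UNPRINTED convention, recorded as the datum `Carriers.Fl` — one common carrier — exactly as `T4OutputRate`
records the background transport; a non-identical identification is served by the optional fourth bracket `LipFluct`);
(d) [v1.1, cell GAPS G-t4r2-2 repair (i)] the identification of the two runs' LARGE-FIELD DATA entering a boundary piece —
the fourth printed argument `{S_i∩X}` of (2.40)–(2.42) p. 261 (and, through the summation conditions X∩Ω_j ≠ ∅, X∩Z_j~ ≠ ∅
of (2.41), the restricted sequences {Ω_i}, {Λ_i}, Z_i = Λ_i^c (2.3)) — after the pairing j ↔ j + 1: an UNPRINTED convention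
of the same kind as (c), recorded by the datum `Carriers.Dom` inherited from `T4OutputRate.Carriers` (*"UNPRINTED
conventions, here taken as already applied and recorded as DATA: a common index type `Dom` of localization domains X"*): an
index `X : C.Dom` stands for a localization domain TOGETHER WITH the restricted large-field data {S_i∩X} of the term of the
expansion (2.18) it belongs to, ONE AND THE SAME for both runs, so that every two-run shape over this carrier (`NE5B` below;
`T4BoundaryRate.BDiscAt` / `T4BoundaryRate.GenLip` of unit `b2b-balaban-t4-ne5-p3`) compares 𝐁^A and 𝐁^B at literally the
same (X, {S_i∩X}, a) — the typed `BFunctional` has NO separate large-field-data argument.  Print has ONE run, in which these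
sequences are SUMMATION VARIABLES of the integral operations: p. 254 (1.29) `T₁({Ω₁, Λ₁}) = Σ_{S₁} ∫ dV₀|… χ(Ω₁∩Λ₁^c, S₁) …` and
*"We consider also a third family of sequences {S_j}, j = 1, 2, …, k, where S_j ⊂ Ω_j∩Λ_j^c, and S_j is either empty, or it
is a union of LM₂R_j-cubes in the lattice T_{L^{−j}}"*; p. 255 *"If Ω_j∩Λ_j^c is nonempty, then S_j is nonempty too; in fact it
contains Ω_j∖Ω_j^{~−1} = Ω_j∩(Ω_j^c)~. There is a characteristic function χ(Ω_j∩Λ_j^c, S_j) associated with these domains, which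
includes a large fluctuation field characteristic function associated with the set R_j = S_j∖(Ω_j∩(Ω_j^c)~)."*; p. 257 *"Summation
over the sequences {S_j} is included in the operation T_k, and the effective action A_k depends on the sequences {Ω_j}, {Λ_j},
{S_j}. We suppress this dependence in our notation, so we will write simply T_k, A_k."*  The cube size is coupling-DEPENDENT —
p. 255 *"R_j is the smallest number of the form L^r such, that R_j ≥ (log g_j^{−2})^r. (2.5)"* — so the two runs' admissible
families {S_i} range over the same unions of cubes only after node U5a's synchronisation of the schedules (cell obligation
O-X14-1), exactly the situation of `admFl` in (c).  A NON-identical identification of the large-field data (𝐁^A at {S_i∩X}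
against 𝐁^B at {S′_i∩X}) is served by NO bracket of this module: it would need one more carrier (`LF` with admissible part
`admLF`, the piece quantified over it — G-t4r2-2 repair (ii)), not built absent a consumer; (e) [v1.1] THE PRINTED DOMAIN of
the analytic extension (2.41)(ii) and of the constant B₀ of (2.42) is the multi-scale space Ũ^c_j(X, α̃₀, α̃₁) of (2.34)–(2.39)
(β = 1/4; for the pieces created in the (k + 1)-st step the (1 + β)-enlarged product space (3.43) p. 276, shrinking afterwards by
the powers of 1/2 of p. 277) — NOT all backgrounds.  The background carriers `BgA`, `BgB` of a `Carriers` instance are abstract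
types; the INTENDED instances are (the real (𝐔, 𝐉)-configurations of) those printed spaces restricted to X, as
`T4OutputRate.Carriers` already stipulates (*"background carriers `BgA`, `BgB` (understood as ALREADY RESTRICTED to the
synchronised small-field / analyticity domains on which the functionals are defined — the instancer chooses the
subtypes)"*), so that `DecayBoundFl B W B₀ κ` with the printed B₀, κ is literally (2.42), uniformly in A; on a larger
background type (2.42) prints nothing and `DecayBoundFl` / `NE5B` are that much stronger hypotheses of the consumer.  Items
(d), (e) change no declaration: every `def`/`theorem` below is byte-identical to v1.

## What is typed and what is proved

§1 CARRIERS.  `Carriers` extends `T4OutputRate.Carriers` (domains with creation step and tree length, the two runs'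
background carriers, run A's closeness gauge, the background transport) by the COMMON carrier `Fl` of pending
fluctuation-field configurations restricted to a domain and its admissible part `admFl` (the printed domain of the
A-argument: the support of the pending small-field characteristic functions, real points of the polydisc `|A| < C₁p₁(g_k)` of
(3.43); after node U5a's synchronisation with a common schedule — obligation O-X14-1 of the cell — the two runs' thresholds
agree, so ONE admissible set is recorded).  `BFunctional C Bg = (ℕ → ℝ) → Bg → C.Fl → C.Dom → ℝ` is the carrier the row asks
for: (re-indexed coupling sequence, background, pending fluctuation field, domain X) ↦ `𝐁^{(j)}(X; g, U, A)`, j = `scale X`;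
`atFl B a` freezes the fluctuation argument and IS a `T4OutputRate.Functional` — so every shape and lemma of node U3 applies
at each fixed `a`, which is the whole design ("parallel structure" realised as an extension + a section).
§2 SHAPES (binders only — nothing asserted), all UNIFORM IN `a ∈ admFl` with a-INDEPENDENT constants: `DecayBoundFl`
(printed form (2.42)); `LipBackgroundFl` (printed-ingredient shape: Lipschitz in the background through the carrier's gauge,
constant family `CU g j` allowed to depend on couplings and scale); `NE9Fl` (joint coupling-Lipschitz with history moduli —
print writes NO coupling argument for boundary pieces, (2.41)/(1.101), whence the degenerate instance `CouplingFree` ⇒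
`NE9Fl` with any nonnegative moduli, `ne9Fl_of_couplingFree`; but the pieces are built from `P^{(k)}(g_k, ·)`, (3.28)–(3.30),
so the general binder is kept); `NE5B` = THE NEW HYPOTHESIS SHAPE: `T4OutputRate.NE5` at every common admissible pending
field, `|𝐁^A(X; g, transport U, a) − 𝐁^B(X; g, U, a)| ≤ C₅θ^{scale X}e^{−κd(X)}`; `LipFluct` (optional fourth bracket:
Lipschitz in the fluctuation argument through a closeness functional `gFl` on `Fl`, constant family `CA g j` — what
analyticity in A on the polydisc of (3.43) plus Cauchy would give, with `CA` of order B₀/(C₁p₁(g_j))).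
§3 BOOKKEEPING [folklore]: `u3B_threeBrackets` / `u3B_geometric` (node U3's decomposition at a common pending field, from
`T4OutputRate.u3_threeBrackets` / `u3_geometric`); `u3B_fourBrackets` (different but admissible pending fields `a`, `a′`:
the extra bracket `CA·gFl a a′`); `URateFl` / `uRateFl_of_u3B` (the conclusion shape along the V-family, uniformly in the
pending field, from `T4RecentScale.uRate_of_u3`); THE HAND-OFF `factorLogRatio_boundary`: under `URateFl` the boundary
factors `f_X(v, a) = exp 𝐁(X; g, U(v), a)` — NO vacuum-energy subtraction (p. 259 *"It does not require any
renormalization"*), hence field-independent constants `c ≡ 0` — satisfy `T4RecentScale.FactorLogRatio` on the admissible set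
`Adm ×ˢ admFl` of the joint driving datum (v, a), with kind `boundary`, scale `C.scale`, weight `e^{−κd(X)}`, kind constant
`E₀′`, `δ ≡ 0` (node U2's discrepancy sits inside `E₀′` through the coupling bracket); and the ONE-LEVEL-DOWN forms consumed by
`T4RecentScale.factorLogBound_of_innerExp` when the pending field is integrated by a positive pending operation:
`boundarySum_bound` (finitely many boundary pieces in one exponent add up: `|Σ_X 𝐁^B − Σ_X 𝐁^A| ≤ E₀′Σ_X θ^{scale X}e^{−κd(X)}`)
and `ae_boundary_bound` (a measure `ν` on `Fl` carried by `admFl` ⇒ the pointwise bound holds ν-a.e., the `hexp` input).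
§4 THE CAUCHY STEP UNIFORM IN THE FLUCTUATION FIELD [cite DimockYuan2024GNFlow]: `lipBackgroundFl_of_analyticMargin` — given,
for every admissible coupling sequence, pending field and domain, an analytic extension `Bc g a X : E → ℂ` of `U ↦ 𝐁(X; g, U,
a)` to a domain `D g X` of a complex normed space `E` of background data (NOT depending on `a` — the product structure of
(3.43)), the sup bound `B₀e^{−κd(X)}` there ((2.42), a-uniform), closed balls of radius `ϱ g j` about the embedded real
backgrounds inside `D g X` (the margin of p. 277), and the carrier's gauge dominating the embedded distance, THEN
`LipBackgroundFl` holds with `CU g j = 4B₀/ϱ g j`, INDEPENDENT of `a` — by `Dimock2015.norm_sub_le_of_margin`.  This is the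
precise sense in which "analytic in the background on the printed domains ⇒ Lipschitz via Cauchy exactly as for E-terms"
holds for boundary pieces: the A-argument is a parameter of the estimate, not an obstruction, AS LONG AS the analytic
extension, the bound and the margin are uniform in it — which is what (2.41)(ii)/(2.42)/(3.43) print and what the
hypotheses record.  `lipFluct_of_analyticMargin` is the same step in the fluctuation argument at fixed background.
§5 NON-VACUITY: the shapes are jointly satisfiable (a one-point instance), so no consumer hypothesis list built from them is
contradictory by shape alone.

Deliberately NOT here: any statement about Bałaban's boundary pieces, T-operations or characteristic functions; the
re-cut of B-terms at recent scales (variant (β-B), REJECTED by the carver: recent large-field weights e^{−p₀(g_j)} are not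
K-summable); the indicator-shell question of background-mediated characteristic functions (row U5b.E2 / hazard G-pv07-4 —
those indicators are factors of the T-operations, kind `pending`, not of the boundary pieces; the characteristic function
χ^{(k)} differentiated in (3.28) is a function of the INTEGRATED field inside an expectation value); the η-rate itself (NE5)
and the background closeness (NE3); old-scale boundary pieces (node U4′/U5c: SIZE bounds (2.42)/(2.48), `T4Crossover`).

CITATION HEADER (lean-in-tree rule 2026-08-18).  Sources quoted: T. Bałaban, *Convergent renormalization expansions for
lattice gauge theories*, Commun. Math. Phys. **119**, 243–285 (1988) [Balaban1988Convergent] (cell paper B14 = [III]; held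
`paper:balaban1988-cmp119-convergent-renormalization`, journal page = PDF page + 242; renders `b2b-balaban-ref1/pages/1988-
cmp119-convergent-renormalization/…-p016/p017/p018/p019/p020/p029/p030/p034/p035/p037-x2.png` read as images by this seat);
T. Bałaban, *Large field renormalization. II. Localization, exponentiation, and bounds for the 𝐑 operation*, Commun. Math.
Phys. **122**, 355–392 (1989) [Balaban1989LargeFieldII] (B16; held `paper:balaban1989-cmp122-large-field-ii`, journal page =
PDF page + 354; renders `…/1989-cmp122-large-field-II/…-p034/p035/p036-x2.png`); T. Bałaban, *Renormalization group approach
to lattice gauge field theories. I*, Commun. Math. Phys. **109**, 249–301 (1987) [Balaban1987RG1] (B12 = [I]; cited through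
`T4OutputRate` only); J. Dimock, C. Yuan, *Structural stability of the RG flow in the Gross–Neveu model*, Ann. Henri
Poincaré **25** (2024) = arXiv:2303.07916v3 [DimockYuan2024GNFlow] (PUBLISHED template literature, outside the audited
series; cited through `Dimock2015.AnalyticLipschitz`).  The Bałaban papers are manuscripts UNDER ADJUDICATION by the audit
cell `pub-balaban`: NOTHING printed in them is asserted here.  NEW module of unit `b2b-balaban-b02-g8` (PAPER SUB-CELL B02
gen 8; journal claim T4-U3.B 2026-08-18T23:07:35Z); imports `T4RecentScale` (hence `T4HybridMatching`, `T4CauchySum`,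
`T4OutputRate`, Mathlib) and `Dimock2015.AnalyticLipschitz`; modifies nothing.  v1.1 (unit `b2b-balaban-b02-g13`, same
lineage, gen 13; journal claim T4-U3.B-DOCFIX-v1.1 2026-08-19T07:27:32Z): DOCSTRING-ONLY answer to the cross-read objection
G-t4r2-2 of unit `b2b-balaban-t4-ref2` (cell record `t4/GAPS-T4.md`), repair (i): the {S_i∩X}-identification named as
convention (d) and the printed domain of B₀ recorded as (e) in the «NOT PRINTED» paragraph above, with pointers in the
docstrings of `Carriers`, `BFunctional`, `DecayBoundFl`, `NE5B`; additional renders read as images for (d): `…-p011/p012/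
p013/p015-x2.png` (pp. 253–255, 257).  No declaration, statement or proof changed; no kernel theorem is affected (all are
implications between the typed binders, as G-t4r2-2 itself records).
-/

namespace Literature.MathematicalPhysics.QuantumFieldTheory.Balaban1983to89.T4BoundaryCarrier

open Finset MeasureTheory T4OutputRate T4RecentScale
open scoped BigOperators

/-! ## §1 Carriers with the pending fluctuation field (the pairing already applied — DATA, not printed) -/

/-- The carriers of the boundary-functional member of node U3: those of `T4OutputRate.Carriers` (domains X with creation
step and tree length, the two runs' background carriers, run A's closeness gauge, the transport run B → run A) EXTENDED by
ONE COMMON carrier `Fl` of pending fluctuation-field configurations `a = A|_X` ((2.41)(i) p. 261: *"it depends on U_k, A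
restricted to X"*) and its admissible part `admFl` (the printed domain of the A-argument, real points of the factor
`{A : supp A ⊂ Y∩Λ^{(k)*}_{k+1}, |A| < C₁p₁(g_k)}` of (3.43) p. 276).  That the two runs' pending variables are identified
after the pairing j ↔ j + 1 and node U5a's synchronisation is an UNPRINTED convention recorded as this datum (header (c));
likewise (header (d), v1.1) the inherited index type `Dom` carries, with each localization domain X, the restricted
large-field data {S_i∩X} of (2.41) p. 261 — identified between the two runs, no separate carrier — and (header (e)) the
intended `BgA`, `BgB` are the real configurations of the printed spaces Ũ^c_j(X, α̃₀, α̃₁) (2.34)–(2.39) / (3.43) restricted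
to X, on which alone (2.42) is printed. [cite: Balaban1988Convergent, (2.41) p.261 and (3.43) p.276] -/
structure Carriers extends T4OutputRate.Carriers where
  /-- common carrier of pending fluctuation-field configurations restricted to a domain -/
  Fl : Type
  /-- admissible pending fields: the printed domain of the A-argument (support of the pending small-field characteristic
  functions; real points of the polydisc of (3.43)) -/
  admFl : Set Fl

/-- THE CARRIER the row asks for: a family of boundary pieces `(g, U, a, X) ↦ 𝐁^{(j)}(X; g, U, a)`, j = `scale X` — a
functional of the (re-indexed) coupling sequence, the background, the PENDING FLUCTUATION FIELD and the domain ((2.41)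
p. 261 `𝐁^{(j)}(X, U_k, A, {S_i∩X})`; the restrictions `{S_i∩X}` are part of the synchronised domain structure, i.e. of the
index X — header convention (d), v1.1: there is NO separate large-field-data argument, so any two-run shape over this
carrier compares the runs' pieces at the SAME {S_i∩X}; a non-identical identification would need an extra carrier, not
built).  Abstract: nothing of the constructions (3.27)–(3.30) pp. 271–272 or (1.98)–(1.101) p. 390 of [Balaban1989LargeFieldII]
is modelled. [cite: Balaban1988Convergent, (2.40)-(2.42) p.261] -/
abbrev BFunctional (C : Carriers) (Bg : Type) : Type := (ℕ → ℝ) → Bg → C.Fl → C.Dom → ℝ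

variable {C : Carriers}

/-- Freezing the fluctuation argument gives a one-step output functional of node U3 (`T4OutputRate.Functional` on the
underlying carriers): every shape and lemma of `T4OutputRate` / `T4RecentScale` §5 applies at each fixed pending field.
[cite: Balaban1988Convergent, (2.41) p.261] -/
abbrev atFl {Bg : Type} (B : BFunctional C Bg) (a : C.Fl) : Functional C.toCarriers Bg := fun g U X => B g U a X

/-- Unfolding `atFl`. [folklore] -/
theorem atFl_apply {Bg : Type} (B : BFunctional C Bg) (a : C.Fl) (g : ℕ → ℝ) (U : Bg) (X : C.Dom) :
    atFl B a g U X = B g U a X := rfl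

/-! ## §2 Hypothesis shapes, uniform in the admissible pending field (binders only — nothing asserted) -/

/-- PRINTED FORM (binder only): the decay bound (2.42) p. 261, `|𝐁^{(j)}(X; g, U, a)| ≤ B₀e^{−κd_j(X)}` for all admissible
couplings, all backgrounds of the carrier and all ADMISSIBLE pending fields — the printed bound is uniform in A.  Printed
only on the space Ũ^c_j(X, α̃₀, α̃₁) of (2.41)(ii) (header (e), v1.1): with the printed B₀ this binder is (2.42) exactly when
the carrier `Bg` is instantiated by (the real points of) that space restricted to X. [cite: Balaban1988Convergent, (2.42) p.261] -/
def DecayBoundFl {Bg : Type} (B : BFunctional C Bg) (W : Set (ℕ → ℝ)) (B₀ κ : ℝ) : Prop :=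
  ∀ a ∈ C.admFl, DecayBound (atFl B a) W B₀ κ

/-- PRINTED-INGREDIENT SHAPE (binder): Lipschitz dependence of the boundary piece on the background through the carrier's
gauge, UNIFORMLY in the admissible pending field, with an a-INDEPENDENT constant family `CU g j` allowed to depend on the
coupling sequence and the scale — what "(ii) it has an extension to an analytic function on the space Ũ^c_j(X, α̃₀, α̃₁)"
(2.41) p. 261 on the product space (3.43) p. 276, the bound (2.42) and a Cauchy estimate with the margin of p. 277 would give
(§4 `lipBackgroundFl_of_analyticMargin` carries the step out given those inputs), with `CU g j` of order `B₀/(βα_{·,n})`,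
the multi-scale radii (2.34)–(2.39) being g-dependent through (2.28) (cell GAPS G-t4-U3-2). [cite: Balaban1988Convergent, (2.41)-(2.42) p.261] -/
def LipBackgroundFl (B : BFunctional C C.BgA) (W : Set (ℕ → ℝ)) (κ : ℝ) (CU : (ℕ → ℝ) → ℕ → ℝ) : Prop :=
  ∀ a ∈ C.admFl, LipBackground (atFl B a) W κ CU

/-- HYPOTHESIS SHAPE (cell NE9 for boundary pieces, NOT PRINTED): joint coupling-Lipschitz dependence with history moduli,
uniformly in the admissible pending field — `T4OutputRate.NE9` at each `a`.  Print writes NO coupling argument for boundary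
pieces ((2.41) p. 261; (1.101) p. 390 of [Balaban1989LargeFieldII]) although they are built from `P^{(k)}(g_k, ·)` and
`𝐄_k` ((3.28)–(3.30) pp. 271–272); see `CouplingFree` for the degenerate instance. [cite: Balaban1988Convergent, (3.28)-(3.30) p.272] -/
def NE9Fl {Bg : Type} (B : BFunctional C Bg) (W : Set (ℕ → ℝ)) (κ : ℝ) (Λ : ℕ → ℕ → ℝ) : Prop :=
  ∀ a ∈ C.admFl, NE9 (atFl B a) W κ Λ

/-- DEGENERATE INSTANCE (binder): the boundary piece does not depend on the coupling sequence on the window — the literal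
reading of the printed notation `𝐁^{(j)}(X, U_k, A, {S_i∩X})` / `𝐁′^{(k)}(X, U_k)` (cell hazard H-X14-3: *"the g-ARGUMENT is
printed only in E-terms / β_jA(φ_j) / 1/g_k² / E_k"*).  Recorded, not recommended. [cite: Balaban1989LargeFieldII, (1.101) p.390] -/
def CouplingFree {Bg : Type} (B : BFunctional C Bg) (W : Set (ℕ → ℝ)) : Prop :=
  ∀ a ∈ C.admFl, ∀ g ∈ W, ∀ g' ∈ W, ∀ (U : Bg) (X : C.Dom), B g U a X = B g' U a X

/-- **HYPOTHESIS SHAPE `NE5B`** (cell NEW ESTIMATE NE5, boundary-functional member — carver decision (α-B); NOT PRINTED):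
the η-RATE of the boundary piece AT FIXED ARGUMENTS — the same re-indexed coupling sequence, the run-B background seen by
run A through the transport, THE SAME admissible pending field, and (header (d), v1.1) the same index X, HENCE THE SAME
restricted large-field data {S_i∩X} of (2.41) in both runs — with the scale-covariant factor `θ^{scale X}` times the
printed decay factor, the constant `C₅` INDEPENDENT of the pending field: `T4OutputRate.NE5` at every `a ∈ admFl`.  Print has
one run and the a-uniform bound (2.42). [cite: Balaban1988Convergent, (2.42) p.261] -/
def NE5B (BA : BFunctional C C.BgA) (BB : BFunctional C C.BgB) (W : Set (ℕ → ℝ)) (κ θ C₅ : ℝ) : Prop :=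
  ∀ a ∈ C.admFl, NE5 (atFl BA a) (atFl BB a) W κ θ C₅

/-- OPTIONAL FOURTH BRACKET (binder; NOT PRINTED as a modulus): Lipschitz dependence on the PENDING FIELD through a closeness
functional `gFl` on `Fl`, between admissible pending fields, with constant family `CA g j` — what analyticity in A on the
polydisc `|A| < C₁p₁(g_k)` of (3.43) p. 276 plus a Cauchy estimate would give (`lipFluct_of_analyticMargin`), `CA` of order
`B₀/(C₁p₁(g_j))`.  Needed only if the two runs' pending variables are identified up to a non-identity map.
[cite: Balaban1988Convergent, (3.43) p.276] -/
def LipFluct {Bg : Type} (B : BFunctional C Bg) (W : Set (ℕ → ℝ)) (κ : ℝ) (gFl : C.Fl → C.Fl → ℝ)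
    (CA : (ℕ → ℝ) → ℕ → ℝ) : Prop :=
  ∀ g ∈ W, ∀ (U : Bg), ∀ a ∈ C.admFl, ∀ a' ∈ C.admFl, ∀ X : C.Dom,
    |B g U a X - B g U a' X| ≤ CA g (C.scale X) * Real.exp (-(κ * C.d X)) * gFl a a'

/-- `CouplingFree` is the degenerate case of `NE9Fl`: with ANY nonnegative history moduli the joint coupling-Lipschitz shape
holds (the left side vanishes). [folklore] -/
theorem ne9Fl_of_couplingFree {Bg : Type} {B : BFunctional C Bg} {W : Set (ℕ → ℝ)} (h : CouplingFree B W) (κ : ℝ)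
    {Λ : ℕ → ℕ → ℝ} (hΛ : ∀ j i, 0 ≤ Λ j i) : NE9Fl B W κ Λ := by
  intro a ha g hg g' hg' U X
  have h0 : atFl B a g U X - atFl B a g' U X = 0 := by
    rw [atFl_apply, atFl_apply, h a ha g hg g' hg' U X, sub_self]
  rw [h0, abs_zero]
  exact mul_nonneg (Real.exp_pos _).le
    (Finset.sum_nonneg fun i _ => mul_nonneg (hΛ _ _) (abs_nonneg _))

/-- A decay bound uniform in the pending field gives, at each admissible pending field, the node-U3 decay bound — the
trivial projection, recorded so that consumers quantify in the right order (constants BEFORE `a`). [folklore] -/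
theorem decayBound_atFl {Bg : Type} {B : BFunctional C Bg} {W : Set (ℕ → ℝ)} {B₀ κ : ℝ} (h : DecayBoundFl B W B₀ κ)
    {a : C.Fl} (ha : a ∈ C.admFl) : DecayBound (atFl B a) W B₀ κ :=
  h a ha

/-! ## §3 Bookkeeping (kernel-checked): brackets, the V-family, and the hand-off to `T4RecentScale` -/

/-- NODE U3's THREE BRACKETS FOR A BOUNDARY PIECE AT A COMMON ADMISSIBLE PENDING FIELD: `NE9Fl` + `LipBackgroundFl` + `NE5B`
and δ-closeness of the backgrounds give `|𝐁^A(X; g^A, U^A, a) − 𝐁^B(X; g^B, U^B, a)| ≤ (C_U(g^A, j)δ + Σ_{i<j}Λ j i|g^A_i − g^B_i|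
+ C₅θ^j)e^{−κd_j(X)}` — `T4OutputRate.u3_threeBrackets` at `a`. [folklore] -/
theorem u3B_threeBrackets {W : Set (ℕ → ℝ)} {BA : BFunctional C C.BgA} {BB : BFunctional C C.BgB}
    {κ θ C₅ : ℝ} {Λ : ℕ → ℕ → ℝ} {CU : (ℕ → ℝ) → ℕ → ℝ}
    (h9 : NE9Fl BA W κ Λ) (hU : LipBackgroundFl BA W κ CU) (h5 : NE5B BA BB W κ θ C₅)
    {gA gB : ℕ → ℝ} (hgA : gA ∈ W) (hgB : gB ∈ W)
    {UA : C.BgA} {UB : C.BgB} {δ : ℝ} (hδ : C.gauge UA (C.transport UB) ≤ δ)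
    {a : C.Fl} (ha : a ∈ C.admFl) (X : C.Dom) (hCU : 0 ≤ CU gA (C.scale X)) :
    |BA gA UA a X - BB gB UB a X| ≤
      (CU gA (C.scale X) * δ
        + (∑ i ∈ Finset.range (C.scale X), Λ (C.scale X) i * |gA i - gB i|)
        + C₅ * θ ^ C.scale X) * Real.exp (-(κ * C.d X)) :=
  u3_threeBrackets (h9 a ha) (hU a ha) (h5 a ha) hgA hgB hδ X hCU

/-- The carver's TARGET SHAPE at a common admissible pending field: if the argument bracket and the coupling bracket are
≤ a₁θ^j and ≤ b₁θ^j, then `|𝐁^A − 𝐁^B| ≤ (a₁ + b₁ + C₅)θ^j e^{−κd_j(X)}` — `T4OutputRate.u3_geometric` at `a`. [folklore] -/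
theorem u3B_geometric {W : Set (ℕ → ℝ)} {BA : BFunctional C C.BgA} {BB : BFunctional C C.BgB}
    {κ θ C₅ : ℝ} {Λ : ℕ → ℕ → ℝ} {CU : (ℕ → ℝ) → ℕ → ℝ}
    (h9 : NE9Fl BA W κ Λ) (hU : LipBackgroundFl BA W κ CU) (h5 : NE5B BA BB W κ θ C₅)
    {gA gB : ℕ → ℝ} (hgA : gA ∈ W) (hgB : gB ∈ W)
    {UA : C.BgA} {UB : C.BgB} {δ : ℝ} (hδ : C.gauge UA (C.transport UB) ≤ δ)
    {a : C.Fl} (ha : a ∈ C.admFl) (X : C.Dom) (hCU : 0 ≤ CU gA (C.scale X)) {a₁ b₁ : ℝ}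
    (ha₁ : CU gA (C.scale X) * δ ≤ a₁ * θ ^ C.scale X)
    (hb₁ : (∑ i ∈ Finset.range (C.scale X), Λ (C.scale X) i * |gA i - gB i|) ≤ b₁ * θ ^ C.scale X) :
    |BA gA UA a X - BB gB UB a X| ≤ (a₁ + b₁ + C₅) * θ ^ C.scale X * Real.exp (-(κ * C.d X)) :=
  u3_geometric (h9 a ha) (hU a ha) (h5 a ha) hgA hgB hδ X hCU ha₁ hb₁

/-- FOUR BRACKETS (different admissible pending fields `a`, `a′` in the two runs, e.g. identified up to a re-blocking):
`LipFluct` on run A moves `a` to `a′` at the cost `CA(g^A, j)·gFl a a′·e^{−κd_j(X)}`, then the three brackets at `a′`.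
[folklore] -/
theorem u3B_fourBrackets {W : Set (ℕ → ℝ)} {BA : BFunctional C C.BgA} {BB : BFunctional C C.BgB}
    {κ θ C₅ : ℝ} {Λ : ℕ → ℕ → ℝ} {CU CA : (ℕ → ℝ) → ℕ → ℝ} {gFl : C.Fl → C.Fl → ℝ}
    (hA : LipFluct BA W κ gFl CA) (h9 : NE9Fl BA W κ Λ) (hU : LipBackgroundFl BA W κ CU)
    (h5 : NE5B BA BB W κ θ C₅) {gA gB : ℕ → ℝ} (hgA : gA ∈ W) (hgB : gB ∈ W)
    {UA : C.BgA} {UB : C.BgB} {δ : ℝ} (hδ : C.gauge UA (C.transport UB) ≤ δ)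
    {a a' : C.Fl} (ha : a ∈ C.admFl) (ha' : a' ∈ C.admFl) (X : C.Dom) (hCU : 0 ≤ CU gA (C.scale X)) :
    |BA gA UA a X - BB gB UB a' X| ≤
      (CA gA (C.scale X) * gFl a a' + CU gA (C.scale X) * δ
        + (∑ i ∈ Finset.range (C.scale X), Λ (C.scale X) i * |gA i - gB i|)
        + C₅ * θ ^ C.scale X) * Real.exp (-(κ * C.d X)) := by
  have h1 : |BA gA UA a X - BA gA UA a' X| ≤ CA gA (C.scale X) * Real.exp (-(κ * C.d X)) * gFl a a' :=
    hA gA hgA UA a ha a' ha' X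
  have h2 := u3B_threeBrackets h9 hU h5 hgA hgB hδ ha' X hCU
  have t := abs_sub_le (BA gA UA a X) (BA gA UA a' X) (BB gB UB a' X)
  have eq : (CA gA (C.scale X) * gFl a a' + CU gA (C.scale X) * δ
        + (∑ i ∈ Finset.range (C.scale X), Λ (C.scale X) i * |gA i - gB i|)
        + C₅ * θ ^ C.scale X) * Real.exp (-(κ * C.d X))
      = CA gA (C.scale X) * Real.exp (-(κ * C.d X)) * gFl a a'
        + (CU gA (C.scale X) * δ
          + (∑ i ∈ Finset.range (C.scale X), Λ (C.scale X) i * |gA i - gB i|)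
          + C₅ * θ ^ C.scale X) * Real.exp (-(κ * C.d X)) := by ring
  rw [eq]
  linarith

section VFamily

variable {V : Type*}

/-- CONSUMER SHAPE of node U3 for boundary pieces ALONG THE V-FAMILY, UNIFORMLY IN THE ADMISSIBLE PENDING FIELD (NOT
PRINTED): for every `a ∈ admFl`, every admissible driving field `v` and every domain `X`,
`|𝐁^A(X; g^A, U^A(v), a) − 𝐁^B(X; g^B, U^B(v), a)| ≤ E₀′θ^{scale X}e^{−κd(X)}` — `T4RecentScale.URate` at each `a`; the
statement "log-ratio of the two runs' boundary factors ≤ C_B·(rate), uniform in the fluctuation field on the printed domain"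
of T4-DAG row U3.B. [cite: Balaban1988Convergent, (2.42) p.261] -/
def URateFl (BA : BFunctional C C.BgA) (BB : BFunctional C C.BgB) (gA gB : ℕ → ℝ) (uA : V → C.BgA) (uB : V → C.BgB)
    (Adm : Set V) (E₀' θ κ : ℝ) : Prop :=
  ∀ a ∈ C.admFl, URate (atFl BA a) (atFl BB a) gA gB uA uB Adm E₀' θ κ

/-- Unfolding `URateFl` to the pointwise bound. [folklore] -/
theorem uRateFl_iff {BA : BFunctional C C.BgA} {BB : BFunctional C C.BgB} {gA gB : ℕ → ℝ} {uA : V → C.BgA}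
    {uB : V → C.BgB} {Adm : Set V} {E₀' θ κ : ℝ} :
    URateFl BA BB gA gB uA uB Adm E₀' θ κ ↔ ∀ a ∈ C.admFl, ∀ v ∈ Adm, ∀ X : C.Dom,
      |BA gA (uA v) a X - BB gB (uB v) a X| ≤ E₀' * θ ^ C.scale X * Real.exp (-(κ * C.d X)) :=
  Iff.rfl

/-- Node U3's three brackets, uniformly along the V-family AND in the admissible pending field: `URateFl` with
`E₀′ = a₁ + b₁ + C₅` from `NE9Fl`, `LipBackgroundFl`, `NE5B`, the V-family closeness of the backgrounds (node U1b / the gauge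
re-cut of `T4RecentScale.gaugeClose_of_split`) and the geometric bounds on the first two brackets. [folklore] -/
theorem uRateFl_of_u3B {W : Set (ℕ → ℝ)} {BA : BFunctional C C.BgA} {BB : BFunctional C C.BgB} {κ θ C₅ : ℝ}
    {Λ : ℕ → ℕ → ℝ} {CU : (ℕ → ℝ) → ℕ → ℝ} (h9 : NE9Fl BA W κ Λ) (hU : LipBackgroundFl BA W κ CU)
    (h5 : NE5B BA BB W κ θ C₅) {gA gB : ℕ → ℝ} (hgA : gA ∈ W) (hgB : gB ∈ W) {uA : V → C.BgA} {uB : V → C.BgB}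
    {Adm : Set V} {δ : ℝ} (hclose : ∀ v ∈ Adm, C.gauge (uA v) (C.transport (uB v)) ≤ δ)
    (hCU : ∀ X : C.Dom, 0 ≤ CU gA (C.scale X)) {a₁ b₁ : ℝ}
    (ha₁ : ∀ X : C.Dom, CU gA (C.scale X) * δ ≤ a₁ * θ ^ C.scale X)
    (hb₁ : ∀ X : C.Dom, (∑ i ∈ Finset.range (C.scale X), Λ (C.scale X) i * |gA i - gB i|) ≤ b₁ * θ ^ C.scale X) :
    URateFl BA BB gA gB uA uB Adm (a₁ + b₁ + C₅) θ κ :=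
  fun a ha => uRate_of_u3 (h9 a ha) (hU a ha) (h5 a ha) hgA hgB hclose hCU ha₁ hb₁

/-- **THE HAND-OFF TO NODE U5b / U5.E-b, kind `boundary`**: under `URateFl` the boundary factors
`f_X(v, a) = exp 𝐁(X; g, U(v), a)` of a term — NO vacuum-energy subtraction (p. 259: *"It does not require any
renormalization."*), hence FIELD-INDEPENDENT constants `c ≡ 0` — satisfy the node-U5b statement `T4RecentScale.FactorLogRatio`
on the admissible set `Adm ×ˢ admFl` of the JOINT driving datum (driving field, pending field), on any finite set `fac` of
domains, with kind `boundary`, scale `C.scale`, weight `e^{−κd(X)}`, kind constant `E₀′` and `δ ≡ 0` (node U2's discrepancy is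
inside `E₀′` through the coupling bracket).  The pending field is integrated LATER by a positive pending operation; for
that reading use `boundarySum_bound` / `ae_boundary_bound` with `T4RecentScale.factorLogBound_of_innerExp`. [folklore] -/
theorem factorLogRatio_boundary {BA : BFunctional C C.BgA} {BB : BFunctional C C.BgB} {gA gB : ℕ → ℝ}
    {uA : V → C.BgA} {uB : V → C.BgB} {Adm : Set V} {E₀' θ κ : ℝ} (h : URateFl BA BB gA gB uA uB Adm E₀' θ κ)
    (fac : Finset C.Dom) (Ck : Kind → ℝ) (hCk : Ck Kind.boundary = E₀') :
    FactorLogRatio (Adm ×ˢ C.admFl) fac (fun _ => Kind.boundary) C.scale (fun X => Real.exp (-(κ * C.d X)))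
      (fun X p => Real.exp (BA gA (uA p.1) p.2 X)) (fun X p => Real.exp (BB gB (uB p.1) p.2 X))
      (fun _ => 0) Ck θ (fun _ => 0) := by
  rintro ⟨v, a⟩ hp X -
  obtain ⟨hv, ha⟩ := Set.mem_prod.mp hp
  refine ⟨Real.exp_pos _, Real.exp_pos _, ?_⟩
  simp only [Real.log_exp, recentProfile, hCk, add_zero, sub_zero]
  rw [abs_sub_comm]
  exact h a ha v hv X

/-- ONE LEVEL DOWN, several boundary pieces in ONE exponent: the pieces of an exponent add, so on the admissible set
`|Σ_{X∈S} 𝐁^B(X; v, a) − Σ_{X∈S} 𝐁^A(X; v, a)| ≤ E₀′ Σ_{X∈S} θ^{scale X}e^{−κd(X)}` — the pointwise exponent bound that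
`T4RecentScale.factorLogBound_of_innerExp` integrates. [folklore] -/
theorem boundarySum_bound {BA : BFunctional C C.BgA} {BB : BFunctional C C.BgB} {gA gB : ℕ → ℝ}
    {uA : V → C.BgA} {uB : V → C.BgB} {Adm : Set V} {E₀' θ κ : ℝ} (h : URateFl BA BB gA gB uA uB Adm E₀' θ κ)
    (S : Finset C.Dom) {v : V} (hv : v ∈ Adm) {a : C.Fl} (ha : a ∈ C.admFl) :
    |∑ X ∈ S, BB gB (uB v) a X - ∑ X ∈ S, BA gA (uA v) a X| ≤
      E₀' * ∑ X ∈ S, θ ^ C.scale X * Real.exp (-(κ * C.d X)) := by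
  rw [← Finset.sum_sub_distrib, Finset.mul_sum]
  refine (Finset.abs_sum_le_sum_abs _ _).trans (Finset.sum_le_sum fun X _ => ?_)
  rw [abs_sub_comm, ← mul_assoc]
  exact h a ha v hv X

/-- ONE LEVEL DOWN, almost-everywhere form: if the pending operation's measure `ν` on `Fl` is carried by the admissible set
(its small-field characteristic functions are part of the measure), the pointwise bound holds ν-a.e. with constant `c = 0` —
literally the `hexp` input of `T4RecentScale.factorLogBound_of_innerExp` for a one-piece exponent. [folklore] -/
theorem ae_boundary_bound [MeasurableSpace C.Fl] {ν : Measure C.Fl} (hν : ∀ᵐ a ∂ν, a ∈ C.admFl)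
    {BA : BFunctional C C.BgA} {BB : BFunctional C C.BgB} {gA gB : ℕ → ℝ} {uA : V → C.BgA} {uB : V → C.BgB}
    {Adm : Set V} {E₀' θ κ : ℝ} (h : URateFl BA BB gA gB uA uB Adm E₀' θ κ) {v : V} (hv : v ∈ Adm) (X : C.Dom) :
    ∀ᵐ a ∂ν, |BB gB (uB v) a X - BA gA (uA v) a X - 0| ≤ E₀' * θ ^ C.scale X * Real.exp (-(κ * C.d X)) :=
  hν.mono fun a ha => by
    rw [sub_zero, abs_sub_comm]
    exact h a ha v hv X

end VFamily

/-! ## §4 The Cauchy step, uniform in the pending field (printed ingredients as hypotheses; Dimock's template) -/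

section Cauchy

open Metric

variable {E : Type*} [NormedAddCommGroup E] [NormedSpace ℂ E]

/-- **ANALYTIC IN THE BACKGROUND WITH A MARGIN ⇒ LIPSCHITZ IN THE BACKGROUND, UNIFORMLY IN THE PENDING FIELD.**  Inputs, for
every admissible coupling sequence `g`, admissible pending field `a` and domain `X` (ALL HYPOTHESES — the printed claims
(2.41)(ii)/(2.42) p. 261 on the product space (3.43) p. 276 with the margin of p. 277, none of them asserted here): an
embedding `ι` of run-A backgrounds into a complex normed space `E` of background data whose distance is dominated by the
carrier's gauge; a domain `D g X ⊆ E` NOT depending on `a`; an extension `Bc g a X : E → ℂ` of `U ↦ 𝐁(X; g, U, a)`, complex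
differentiable on `D g X`, bounded there by `B₀e^{−κd(X)}` uniformly in `a`, agreeing with the real values at embedded
backgrounds; closed balls of radius `ϱ g (scale X) > 0` about embedded backgrounds inside `D g X`.  Output: `LipBackgroundFl`
with the a-INDEPENDENT constant family `CU g j = 4B₀/ϱ g j` — by `Dimock2015.norm_sub_le_of_margin` (template
[DimockYuan2024GNFlow] Thm 4: *"The analyticity implies Lipschitz continuity in x_k and it is uniform in t"*).
[cite: DimockYuan2024GNFlow, proof of Thm 4 (arXiv:2303.07916v3 TeX ll. 4073–4076)] -/
theorem lipBackgroundFl_of_analyticMargin {B : BFunctional C C.BgA} {W : Set (ℕ → ℝ)} {κ B₀ : ℝ}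
    (ι : C.BgA → E) (D : (ℕ → ℝ) → C.Dom → Set E) (ϱ : (ℕ → ℝ) → ℕ → ℝ)
    (Bc : (ℕ → ℝ) → C.Fl → C.Dom → E → ℂ)
    (hϱ : ∀ g ∈ W, ∀ j, 0 < ϱ g j)
    (hhol : ∀ g ∈ W, ∀ a ∈ C.admFl, ∀ X : C.Dom, DifferentiableOn ℂ (Bc g a X) (D g X))
    (hbd : ∀ g ∈ W, ∀ a ∈ C.admFl, ∀ X : C.Dom, ∀ z ∈ D g X, ‖Bc g a X z‖ ≤ B₀ * Real.exp (-(κ * C.d X)))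
    (hmargin : ∀ g ∈ W, ∀ (X : C.Dom) (U : C.BgA), closedBall (ι U) (ϱ g (C.scale X)) ⊆ D g X)
    (hreal : ∀ g ∈ W, ∀ a ∈ C.admFl, ∀ (X : C.Dom) (U : C.BgA), Bc g a X (ι U) = (B g U a X : ℂ))
    (hgauge : ∀ U U' : C.BgA, ‖ι U - ι U'‖ ≤ C.gauge U U') :
    LipBackgroundFl B W κ (fun g j => 4 * B₀ / ϱ g j) := by
  intro a ha g hg U U' X
  rw [atFl_apply, atFl_apply]
  have hS : ∀ y ∈ Set.range ι, closedBall y (ϱ g (C.scale X)) ⊆ D g X := by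
    rintro _ ⟨U'', rfl⟩
    exact hmargin g hg X U''
  have h := Dimock2015.norm_sub_le_of_margin (hϱ g hg (C.scale X)) (hhol g hg a ha X) (hbd g hg a ha X) hS
    (Set.mem_range_self U) (Set.mem_range_self U')
  rw [hreal g hg a ha X U, hreal g hg a ha X U', ← Complex.ofReal_sub, Complex.norm_real, Real.norm_eq_abs] at h
  have hM0 : 0 ≤ B₀ * Real.exp (-(κ * C.d X)) :=
    (norm_nonneg _).trans (hbd g hg a ha X _ (hmargin g hg X U (mem_closedBall_self (hϱ g hg _).le)))
  have hK : 0 ≤ 4 * (B₀ * Real.exp (-(κ * C.d X))) / ϱ g (C.scale X) :=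
    div_nonneg (mul_nonneg (by norm_num) hM0) (hϱ g hg _).le
  calc |B g U a X - B g U' a X|
      ≤ 4 * (B₀ * Real.exp (-(κ * C.d X))) / ϱ g (C.scale X) * ‖ι U - ι U'‖ := h
    _ ≤ 4 * (B₀ * Real.exp (-(κ * C.d X))) / ϱ g (C.scale X) * C.gauge U U' :=
        mul_le_mul_of_nonneg_left (hgauge U U') hK
    _ = 4 * B₀ / ϱ g (C.scale X) * Real.exp (-(κ * C.d X)) * C.gauge U U' := by ring

/-- THE SAME STEP IN THE PENDING FIELD at fixed background (the factor `{A : …, |A| < C₁p₁(g_k)}` of (3.43) p. 276 read as a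
complex polydisc — a HYPOTHESIS): an embedding `ιF` of pending fields into a complex normed space `E` with distance dominated
by `gFl`, an a-domain `DF g X` containing the closed `ϱ g (scale X)`-balls about embedded ADMISSIBLE pending fields, an
extension of `a ↦ 𝐁(X; g, U, a)` complex differentiable and bounded by `B₀e^{−κd(X)}` there ⇒ `LipFluct` with
`CA g j = 4B₀/ϱ g j`. [cite: DimockYuan2024GNFlow, proof of Thm 4 (arXiv:2303.07916v3 TeX ll. 4073–4076)] -/
theorem lipFluct_of_analyticMargin {Bg : Type} {B : BFunctional C Bg} {W : Set (ℕ → ℝ)} {κ B₀ : ℝ}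
    (ιF : C.Fl → E) (gFl : C.Fl → C.Fl → ℝ) (DF : (ℕ → ℝ) → C.Dom → Set E) (ϱ : (ℕ → ℝ) → ℕ → ℝ)
    (Bc : (ℕ → ℝ) → Bg → C.Dom → E → ℂ)
    (hϱ : ∀ g ∈ W, ∀ j, 0 < ϱ g j)
    (hhol : ∀ g ∈ W, ∀ (U : Bg) (X : C.Dom), DifferentiableOn ℂ (Bc g U X) (DF g X))
    (hbd : ∀ g ∈ W, ∀ (U : Bg) (X : C.Dom), ∀ z ∈ DF g X, ‖Bc g U X z‖ ≤ B₀ * Real.exp (-(κ * C.d X)))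
    (hmargin : ∀ g ∈ W, ∀ (X : C.Dom), ∀ a ∈ C.admFl, closedBall (ιF a) (ϱ g (C.scale X)) ⊆ DF g X)
    (hreal : ∀ g ∈ W, ∀ (U : Bg) (X : C.Dom), ∀ a ∈ C.admFl, Bc g U X (ιF a) = (B g U a X : ℂ))
    (hgFl : ∀ a a' : C.Fl, ‖ιF a - ιF a'‖ ≤ gFl a a') :
    LipFluct B W κ gFl (fun g j => 4 * B₀ / ϱ g j) := by
  intro g hg U a ha a' ha' X
  have hS : ∀ y ∈ ιF '' C.admFl, closedBall y (ϱ g (C.scale X)) ⊆ DF g X := by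
    rintro _ ⟨a'', ha'', rfl⟩
    exact hmargin g hg X a'' ha''
  have h := Dimock2015.norm_sub_le_of_margin (hϱ g hg (C.scale X)) (hhol g hg U X) (hbd g hg U X) hS
    (Set.mem_image_of_mem _ ha) (Set.mem_image_of_mem _ ha')
  rw [hreal g hg U X a ha, hreal g hg U X a' ha', ← Complex.ofReal_sub, Complex.norm_real, Real.norm_eq_abs] at h
  have hM0 : 0 ≤ B₀ * Real.exp (-(κ * C.d X)) :=
    (norm_nonneg _).trans (hbd g hg U X _ (hmargin g hg X a ha (mem_closedBall_self (hϱ g hg _).le)))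
  have hK : 0 ≤ 4 * (B₀ * Real.exp (-(κ * C.d X))) / ϱ g (C.scale X) :=
    div_nonneg (mul_nonneg (by norm_num) hM0) (hϱ g hg _).le
  calc |B g U a X - B g U a' X|
      ≤ 4 * (B₀ * Real.exp (-(κ * C.d X))) / ϱ g (C.scale X) * ‖ιF a - ιF a'‖ := h
    _ ≤ 4 * (B₀ * Real.exp (-(κ * C.d X))) / ϱ g (C.scale X) * gFl a a' :=
        mul_le_mul_of_nonneg_left (hgFl a a') hK
    _ = 4 * B₀ / ϱ g (C.scale X) * Real.exp (-(κ * C.d X)) * gFl a a' := by ring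

end Cauchy

/-! ## §5 Non-vacuity of the hypothesis list (a one-point instance) -/

/-- The one-point carriers: one domain of scale 0 and length 0, one background per run, zero gauge, one pending field,
everything admissible. [folklore] -/
def trivialCarriers : Carriers where
  Dom := Unit
  scale := fun _ => 0
  d := fun _ => 0
  d_nonneg := fun _ => le_rfl
  BgA := Unit
  BgB := Unit
  gauge := fun _ _ => 0
  gauge_nonneg := fun _ _ => le_rfl
  transport := fun _ => ()
  Fl := Unit
  admFl := Set.univ

/-- NON-VACUITY: on the one-point carriers the zero boundary functionals satisfy `DecayBoundFl`, `LipBackgroundFl`,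
`NE9Fl`, `NE5B` and `LipFluct` simultaneously (all constants 0, θ = 1/2) — the shapes are jointly satisfiable, so a consumer's
hypothesis list built from them is not contradictory by shape alone.  (Says nothing about Bałaban's pieces.) [folklore] -/
theorem shapes_nonvacuous :
    let C := trivialCarriers
    let BA : BFunctional C C.BgA := fun _ _ _ _ => 0
    let BB : BFunctional C C.BgB := fun _ _ _ _ => 0
    DecayBoundFl BA (Window 1) 0 1 ∧ LipBackgroundFl BA (Window 1) 1 (fun _ _ => 0) ∧
      NE9Fl BA (Window 1) 1 (fun _ _ => 0) ∧ NE5B BA BB (Window 1) 1 (1 / 2) 0 ∧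
      LipFluct BA (Window 1) 1 (fun _ _ => 0) (fun _ _ => 0) := by
  refine ⟨?_, ?_, ?_, ?_, ?_⟩
  · intro a _ g _ U X
    simp [atFl_apply]
  · intro a _ g _ U U' X
    simp [atFl_apply]
  · intro a _ g _ g' _ U X
    simp [atFl_apply]
  · intro a _ g _ U X
    simp [atFl_apply]
  · intro g _ U a _ a' _ X
    simp

end Literature.MathematicalPhysics.QuantumFieldTheory.Balaban1983to89.T4BoundaryCarrier
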